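import Summits.QuantumFields.GaugeBoot.DiagonalRPTorusEvenBackLayer
import Summits.QuantumFields.GaugeBoot.ClassFunctionConvolution
import HarnessLib

/-!
# Diagonal RP on the even two-torus, gauge-invariant sector, all couplings — III: the cut weight
averages to convolution powers (gauge-boot, L3 supplement)

HONEST FRAMING (cell `pub-gaugeboot`, page 1 of every file): the venture produces certified bounds
on lattice expectations at stated coupling, gauge group, dimension and torus size; NOT a mass gap,
NOT a continuum limit, NOT a string tension; NOT Yang–Mills-summit-bearing (barriers
`FixedCouplingUltralocality`, `PerturbativeInvisibility`). This module is part of a POSITIVE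
structural result (`DiagonalRPTorusEvenGaugeInvariantAllGroups.lean`).

With `w = w_β = exp(β Re tr ρ)` (`TwistedSlab.wilsonWeight`, a continuous inversion-symmetric
class function for EVERY real `β`), the weight of the two cut layers of the even torus is
`E(U) = ∏_{t<L} w(C_t D_t⁻¹) · ∏_{t<L} w(D'_t C'_t⁻¹)` (`C_t, D_t` the crossing transports at the
mirror sites `dg t`, `D'_t, C'_t` those at the back-layer sites `dgc t`; `crossE_eq`). Averaging
the half-gauge bumps at `dg 1, …, dg (L-1)` one at a time glues the mirror factors into
`w^{⋆(s+1)}(C_0⋯C_s (D_0⋯D_s)⁻¹) ∏_{t>s} w(C_t D_t⁻¹)` (`mirW s`; `integral_mirW_halfGauge`, the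
gluing rule `ClassConv.integral_mul_inv_mul_eq_conv`), and the bump at `dg 0` closes the cycle:
`∫ w^{⋆L}(x C x⁻¹ D⁻¹) dx = A_{w^{⋆L}}(stairC, stairD)` (`mirK`; `integral_mirW_halfGauge_zero`);
likewise on the back layer (`backW`, `backK`). By the averaging lemma of part I
(`integral_gg_mul_eq_avg`) each step leaves `∫ g conj(g∘Θ) · (weight) dU` unchanged, whence

★ `integral_rpPhi_eq_kernels`:
`∫ g conj(g∘Θ) E dU = ∫ g conj(g∘Θ) · A_{w^{⋆L}}(stairC L U, stairD L U) · A_{w^{⋆L}}(stairDc L U, stairCc L U) dU`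
for every gauge-invariant closed-half observable (`L ≥ 4` even, every real `β`, compact
metrisable `G`). In characters `A_{w^{⋆L}}(C, D) = Σ_λ ŵ_λ^L χ_λ(C) conj χ_λ(D)` (Migdal's formula for
the `L`-plaquette annulus between the two staircases); no character theory is used here.

References: A. A. Migdal, Sov. Phys. JETP 42 (1975) 413; J.-M. Drouffe, J.-B. Zuber, Phys. Rep.
102 (1983) 1, §3; K. Osterwalder, E. Seiler, Ann. Phys. 110 (1978) 440, §2.
-/

open MeasureTheory Complex Finset Function
open scoped ComplexOrder ENNReal

namespace Summit.QuantumFields.GaugeBoot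

open Literature.MathematicalPhysics.QuantumFieldTheory
open Literature.RepresentationTheory.CompactGroups

noncomputable section

namespace DiagRPTwo

/-! ## The partially averaged weights -/

section Weights

variable {L N : ℕ} [NeZero L] {G : Type*} [Group G] [TopologicalSpace G] [IsTopologicalGroup G]
  [CompactSpace G] [MeasurableSpace G] [BorelSpace G]
  (ρ : G →* Matrix (Fin N) (Fin N) ℂ) (i j : Fin 2) (β : ℝ)

/-- The mirror-layer weight after averaging the bumps at `dg 1, …, dg s`:
`w^{⋆(s+1)}(C_0⋯C_s (D_0⋯D_s)⁻¹) · ∏_{s<t<L} w(C_t D_t⁻¹)`. -/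
def mirW (s : ℕ) (U : GaugeConfig 2 L G) : ℝ :=
  ClassConv.cpow (TwistedSlab.wilsonWeight ρ β) s (stairC i j (s + 1) U * (stairD i j (s + 1) U)⁻¹) *
    ∏ t ∈ Finset.Ico (s + 1) L,
      TwistedSlab.wilsonWeight ρ β (cT i j U (dg t) * (dT i j U (dg t))⁻¹)

/-- The back-layer weight after averaging the bumps at `dgc 1, …, dgc s`. -/
def backW (s : ℕ) (U : GaugeConfig 2 L G) : ℝ :=
  ClassConv.cpow (TwistedSlab.wilsonWeight ρ β) s (stairDc i j (s + 1) U * (stairCc i j (s + 1) U)⁻¹) *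
    ∏ t ∈ Finset.Ico (s + 1) L,
      TwistedSlab.wilsonWeight ρ β (dT i j U (dgc i t) * (cT i j U (dgc i t))⁻¹)

/-- The fully averaged mirror-layer weight `A_{w^{⋆L}}(stairC L U, stairD L U)`. -/
def mirK (U : GaugeConfig 2 L G) : ℝ :=
  ClassConv.twoSided (ClassConv.cpow (TwistedSlab.wilsonWeight ρ β) (L - 1)) (stairC i j L U) (stairD i j L U)

/-- The fully averaged back-layer weight `A_{w^{⋆L}}(stairDc L U, stairCc L U)`. -/
def backK (U : GaugeConfig 2 L G) : ℝ :=
  ClassConv.twoSided (ClassConv.cpow (TwistedSlab.wilsonWeight ρ β) (L - 1)) (stairDc i j L U) (stairCc i j L U)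

variable {ρ i j β}

/-- The crossing weight is the product of the two unaveraged layer weights. -/
theorem crossE_eq (h4 : 4 ≤ L) (hij : i ≠ j) (hρ : Continuous ρ) (U : GaugeConfig 2 L G) :
    crossE ρ i j β U = mirW ρ i j β 0 U * backW ρ i j β 0 U := by
  have hL : 0 < L := by omega
  have h0 : Real.exp (β * ∑ y ∈ S0 i j, rr ρ i j U y) = mirW ρ i j β 0 U := by
    rw [sum_S0_eq_sum_range hij, Finset.mul_sum, Real.exp_sum, Finset.prod_range_eq_mul_Ico _ hL, mirW,
      ClassConv.cpow_zero, zero_add, stairC_succ, stairD_succ, stairC_zero, stairD_zero, one_mul, one_mul]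
    rfl
  have hc : Real.exp (β * ∑ y ∈ Sc i j, rr ρ i j U y) = backW ρ i j β 0 U := by
    rw [sum_Sc_eq_sum_range h4 hij, Finset.mul_sum, Real.exp_sum, Finset.prod_range_eq_mul_Ico _ hL,
      backW, ClassConv.cpow_zero, zero_add, stairDc_succ, stairCc_succ, stairDc_zero, stairCc_zero,
      one_mul, one_mul]
    have hw : ∀ t : ℕ, Real.exp (β * rr ρ i j U (dgc i t)) =
        TwistedSlab.wilsonWeight ρ β (dT i j U (dgc i t) * (cT i j U (dgc i t))⁻¹) := fun t => by
      rw [← TwistedSlab.wilsonWeight_inv ρ hρ β, mul_inv_rev, inv_inv]; rfl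
    rw [hw]
    exact congrArg _ (Finset.prod_congr rfl fun t _ => hw t)
  rw [crossE, mul_add, Real.exp_add, h0, hc]

/-! ### Continuity -/

omit [NeZero L] in
/-- `mirW` is continuous. -/
theorem continuous_mirW [SecondCountableTopology G] (hρ : Continuous ρ) (s : ℕ) :
    Continuous (mirW (L := L) ρ i j β s) := by
  have hw := TwistedSlab.continuous_wilsonWeight ρ hρ β
  exact ((ClassConv.continuous_cpow hw s).comp
    ((continuous_stairC _).mul (continuous_stairD _).inv)).mul
    (continuous_finsetProd _ fun t _ => hw.comp ((continuous_cT _).mul (continuous_dT _).inv))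

omit [NeZero L] in
/-- `backW` is continuous. -/
theorem continuous_backW [SecondCountableTopology G] (hρ : Continuous ρ) (s : ℕ) :
    Continuous (backW (L := L) ρ i j β s) := by
  have hw := TwistedSlab.continuous_wilsonWeight ρ hρ β
  exact ((ClassConv.continuous_cpow hw s).comp
    ((continuous_stairDc _).mul (continuous_stairCc _).inv)).mul
    (continuous_finsetProd _ fun t _ => hw.comp ((continuous_dT _).mul (continuous_cT _).inv))

omit [NeZero L] in
/-- `mirK` is continuous. -/
theorem continuous_mirK [SecondCountableTopology G] (hρ : Continuous ρ) :
    Continuous (mirK (L := L) ρ i j β) :=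
  (ClassConv.continuous_twoSided (ClassConv.continuous_cpow (TwistedSlab.continuous_wilsonWeight ρ hρ β) _)).comp
    ((continuous_stairC _).prodMk (continuous_stairD _))

omit [NeZero L] in
/-- `backK` is continuous. -/
theorem continuous_backK [SecondCountableTopology G] (hρ : Continuous ρ) :
    Continuous (backK (L := L) ρ i j β) :=
  (ClassConv.continuous_twoSided (ClassConv.continuous_cpow (TwistedSlab.continuous_wilsonWeight ρ hρ β) _)).comp
    ((continuous_stairDc _).prodMk (continuous_stairCc _))

/-! ### Invariance under bumps on the other layer -/

/-- The back-layer weight does not see bumps on the mirror. -/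
theorem backW_halfGauge_dg (hL : Even L) (h4 : 4 ≤ L) (hij : i ≠ j) (a : ℕ) (x : G) (s : ℕ)
    (U : GaugeConfig 2 L G) :
    backW ρ i j β s (halfGauge i j (dg a) x U) = backW ρ i j β s U := by
  have hz : kd i j (dg a : Site 2 L) ≠ cc L := by rw [kd_dg]; exact (cc_ne_zero h4).symm
  unfold backW
  rw [stairDc_halfGauge_dg h4 hij, stairCc_halfGauge hL h4 hij]
  congr 1
  refine Finset.prod_congr rfl fun t _ => ?_
  rw [dT_halfGauge_of_kd_cc_of_ne h4 hij hz x U (kd_dgc hij t), cT_halfGauge_of_kd_cc hL h4 hij _ x U (kd_dgc hij t)]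

/-- The averaged mirror weight does not see bumps on the back layer. -/
theorem mirK_halfGauge_dgc (h4 : 4 ≤ L) (hij : i ≠ j) (a : ℕ) (x : G) (U : GaugeConfig 2 L G) :
    mirK ρ i j β (halfGauge i j (dgc i a) x U) = mirK ρ i j β U := by
  unfold mirK
  rw [stairC_halfGauge_dgc h4 hij, stairD_halfGauge h4 hij]

/-! ### One averaging step on the mirror -/

/-- ★ Averaging the bump at `dg (s+1)` glues the next mirror factor:
`∫ mirW s (halfGauge (dg (s+1)) x U) dx = mirW (s+1) U` (`s + 2 ≤ L`). -/
theorem integral_mirW_halfGauge (h4 : 4 ≤ L) (hij : i ≠ j) {s : ℕ}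
    (hs : s + 2 ≤ L) (U : GaugeConfig 2 L G) :
    ∫ x, mirW ρ i j β s (halfGauge i j (dg (s + 1)) x U) ∂(haarProbability G) = mirW ρ i j β (s + 1) U := by
  set w := TwistedSlab.wilsonWeight ρ β with hwdef
  have hwc : ∀ g k, w (g * k * g⁻¹) = w k := TwistedSlab.wilsonWeight_conj ρ β
  have huc : ∀ g k, ClassConv.cpow w s (g * k * g⁻¹) = ClassConv.cpow w s k := ClassConv.cpow_conj hwc s
  -- the transformed weight, pointwise in `x`
  have hpt : ∀ x' : G, mirW ρ i j β s (halfGauge i j (dg (s + 1)) x' U) =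
      ClassConv.cpow w s (stairC i j (s + 1) U * x'⁻¹ * (stairD i j (s + 1) U)⁻¹) *
        w (x' * cT i j U (dg (s + 1)) * (dT i j U (dg (s + 1)))⁻¹) *
        ∏ t ∈ Finset.Ico (s + 1 + 1) L, w (cT i j U (dg t) * (dT i j U (dg t))⁻¹) := by
    intro x'
    have hb0' : bump (dg (s + 1) : Site 2 L) x' (dg 0) = 1 :=
      bump_of_ne (dg_ne_dg' (by omega) (by omega) (by omega)) x'
    have hb2' : bump (dg (s + 1) : Site 2 L) x' (dg (s + 1 + 1)) = 1 :=
      bump_of_ne (dg_ne_dg (by omega) (by omega) (by omega) hs) x'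
    unfold mirW
    rw [stairC_halfGauge h4 hij, stairD_halfGauge h4 hij, hb0', bump_self, one_mul,
      Finset.prod_eq_prod_Ico_succ_bot (by omega : s + 1 < L),
      cT_halfGauge_of_kd_zero h4 hij _ x' U (kd_dg i j (s + 1)),
      dT_halfGauge_of_kd_zero h4 hij _ x' U (kd_dg i j (s + 1)), dg_shift_shift hij, bump_self, hb2',
      inv_one, mul_one, mul_assoc (ClassConv.cpow w s _)]
    congr 2
    refine Finset.prod_congr rfl fun t ht => ?_
    rw [Finset.mem_Ico] at ht
    rw [cT_halfGauge_of_kd_zero h4 hij _ x' U (kd_dg i j t), dT_halfGauge_of_kd_zero h4 hij _ x' U (kd_dg i j t),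
      dg_shift_shift hij, bump_of_ne (dg_ne_dg (by omega) (by omega) (by omega) (by omega)) x',
      bump_of_ne (dg_ne_dg (by omega) (by omega) (by omega) (by omega)) x', one_mul, inv_one, mul_one]
  simp_rw [hpt]
  rw [integral_mul_const, ClassConv.integral_glue huc hwc]
  unfold mirW
  rw [ClassConv.cpow_succ, stairC_succ (s + 1) U, stairD_succ (s + 1) U]
  congr 2
  group

/-- ★ Averaging the bump at `dg 0` closes the mirror cycle:
`∫ mirW (L-1) (halfGauge (dg 0) x U) dx = A_{w^{⋆L}}(stairC L U, stairD L U)`. -/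
theorem integral_mirW_halfGauge_zero (h4 : 4 ≤ L) (hij : i ≠ j) (U : GaugeConfig 2 L G) :
    ∫ x, mirW ρ i j β (L - 1) (halfGauge i j (dg 0) x U) ∂(haarProbability G) = mirK ρ i j β U := by
  have hL1 : L - 1 + 1 = L := Nat.sub_add_cancel (by omega)
  have hpt : ∀ x : G, mirW ρ i j β (L - 1) (halfGauge i j (dg 0) x U) =
      ClassConv.cpow (TwistedSlab.wilsonWeight ρ β) (L - 1)
        (x * stairC i j L U * x⁻¹ * (stairD i j L U)⁻¹) := fun x => by
    unfold mirW
    rw [hL1, Finset.Ico_self, Finset.prod_empty, mul_one, stairC_halfGauge h4 hij,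
      stairD_halfGauge h4 hij, dg_self, bump_self]
  simp_rw [hpt]
  rfl

/-! ### One averaging step on the back layer -/

/-- ★ Averaging the bump at `dgc (s+1)` glues the next back-layer factor (`s + 2 ≤ L`). -/
theorem integral_backW_halfGauge (h4 : 4 ≤ L) (hij : i ≠ j) (hL : Even L) {s : ℕ}
    (hs : s + 2 ≤ L) (U : GaugeConfig 2 L G) :
    ∫ x, backW ρ i j β s (halfGauge i j (dgc i (s + 1)) x U) ∂(haarProbability G) =
      backW ρ i j β (s + 1) U := by
  set w := TwistedSlab.wilsonWeight ρ β with hwdef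
  have hwc : ∀ g k, w (g * k * g⁻¹) = w k := TwistedSlab.wilsonWeight_conj ρ β
  have huc : ∀ g k, ClassConv.cpow w s (g * k * g⁻¹) = ClassConv.cpow w s k := ClassConv.cpow_conj hwc s
  have hpt : ∀ x' : G, backW ρ i j β s (halfGauge i j (dgc i (s + 1)) x' U) =
      ClassConv.cpow w s (stairDc i j (s + 1) U * x'⁻¹ * (stairCc i j (s + 1) U)⁻¹) *
        w (x' * dT i j U (dgc i (s + 1)) * (cT i j U (dgc i (s + 1)))⁻¹) *
        ∏ t ∈ Finset.Ico (s + 1 + 1) L, w (dT i j U (dgc i t) * (cT i j U (dgc i t))⁻¹) := by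
    intro x'
    have hb0' : bump (dgc i (s + 1) : Site 2 L) x' (dgc i 0) = 1 :=
      bump_of_ne (dgc_ne_dgc' hij (by omega) (by omega) (by omega)) x'
    have hb2' : bump (dgc i (s + 1) : Site 2 L) x' (dgc i (s + 1 + 1)) = 1 :=
      bump_of_ne (dgc_ne_dgc hij (by omega) (by omega) (by omega) hs) x'
    unfold backW
    rw [stairDc_halfGauge h4 hij, stairCc_halfGauge hL h4 hij, hb0', bump_self, one_mul,
      Finset.prod_eq_prod_Ico_succ_bot (by omega : s + 1 < L),
      dT_halfGauge_of_kd_cc h4 hij _ x' U (kd_dgc hij (s + 1)),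
      cT_halfGauge_of_kd_cc hL h4 hij _ x' U (kd_dgc hij (s + 1)), dgc_shift_shift hij, bump_self, hb2',
      inv_one, mul_one, mul_assoc (ClassConv.cpow w s _)]
    congr 2
    refine Finset.prod_congr rfl fun t ht => ?_
    rw [Finset.mem_Ico] at ht
    rw [dT_halfGauge_of_kd_cc h4 hij _ x' U (kd_dgc hij t), cT_halfGauge_of_kd_cc hL h4 hij _ x' U (kd_dgc hij t),
      dgc_shift_shift hij, bump_of_ne (dgc_ne_dgc hij (by omega) (by omega) (by omega) (by omega)) x',
      bump_of_ne (dgc_ne_dgc hij (by omega) (by omega) (by omega) (by omega)) x', one_mul, inv_one, mul_one]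
  simp_rw [hpt]
  rw [integral_mul_const, ClassConv.integral_glue huc hwc]
  unfold backW
  rw [ClassConv.cpow_succ, stairDc_succ (s + 1) U, stairCc_succ (s + 1) U]
  congr 2
  group

/-- ★ Averaging the bump at `dgc 0` closes the back-layer cycle. -/
theorem integral_backW_halfGauge_zero (h4 : 4 ≤ L) (hij : i ≠ j) (hL : Even L) (U : GaugeConfig 2 L G) :
    ∫ x, backW ρ i j β (L - 1) (halfGauge i j (dgc i 0) x U) ∂(haarProbability G) = backK ρ i j β U := by
  have hL1 : L - 1 + 1 = L := Nat.sub_add_cancel (by omega)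
  have hpt : ∀ x : G, backW ρ i j β (L - 1) (halfGauge i j (dgc i 0) x U) =
      ClassConv.cpow (TwistedSlab.wilsonWeight ρ β) (L - 1)
        (x * stairDc i j L U * x⁻¹ * (stairCc i j L U)⁻¹) := fun x => by
    unfold backW
    rw [hL1, Finset.Ico_self, Finset.prod_empty, mul_one, stairDc_halfGauge h4 hij,
      stairCc_halfGauge hL h4 hij, dgc_self, bump_self]
  simp_rw [hpt]
  rfl

end Weights

/-! ## Assembling: the cut weight may be replaced by the product of the two averaged kernels -/

section Assembly

variable {L N : ℕ} [NeZero L] {G : Type*} [Group G] [TopologicalSpace G] [IsTopologicalGroup G]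
  [CompactSpace G] [MeasurableSpace G] [BorelSpace G] [SecondCountableTopology G]
  (ρ : G →* Matrix (Fin N) (Fin N) ℂ)

/-- The mirror induction: after `s` steps (`s ≤ L - 1`). -/
theorem integral_rpPhi_eq_mirW (hL : Even L) (h4 : 4 ≤ L) {i j : Fin 2} (hij : i ≠ j)
    (hρ : Continuous ρ) (β : ℝ) {F : GaugeConfig 2 L G → ℂ} (hF : Measurable F)
    {CF : ℝ} (hFb : ∀ U, ‖F U‖ ≤ CF) (hFH : IsDiagonalHalfObservable i j F) (hFg : IsGaugeInvariant F)
    {s : ℕ} (hs : s + 1 ≤ L) :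
    ∫ U, rpPhi ρ i j β F U ∂(linkMeasure L G) =
      ∫ U, gg ρ i j β F U * ((mirW ρ i j β s U * backW ρ i j β 0 U : ℝ) : ℂ) ∂(linkMeasure L G) := by
  induction s with
  | zero =>
    refine integral_congr_ae (ae_of_all _ fun U => ?_)
    show gObs ρ i j β F U * (starRingEnd ℂ) (gObs ρ i j β F (configDiagSwap i j U)) * (crossE ρ i j β U : ℂ) = _
    rw [crossE_eq h4 hij hρ]
    rfl
  | succ s ih =>
    rw [ih (by omega)]
    refine (integral_gg_mul_eq_avg ρ hL h4 hij hρ β hF hFb hFH hFg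
      (R := fun U => mirW ρ i j β s U * backW ρ i j β 0 U)
      ((continuous_mirW hρ s).mul (continuous_backW hρ 0)) (dg (s + 1))).trans ?_
    refine integral_congr_ae (ae_of_all _ fun U => ?_)
    dsimp only
    congr 2
    have hpt : ∀ x : G, mirW ρ i j β s (halfGauge i j (dg (s + 1)) x U) *
        backW ρ i j β 0 (halfGauge i j (dg (s + 1)) x U) =
        mirW ρ i j β s (halfGauge i j (dg (s + 1)) x U) * backW ρ i j β 0 U := fun x => by
      rw [backW_halfGauge_dg hL h4 hij]
    simp_rw [hpt]
    rw [integral_mul_const, integral_mirW_halfGauge h4 hij (by omega)]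

/-- The mirror cycle closed. -/
theorem integral_rpPhi_eq_mirK (hL : Even L) (h4 : 4 ≤ L) {i j : Fin 2} (hij : i ≠ j)
    (hρ : Continuous ρ) (β : ℝ) {F : GaugeConfig 2 L G → ℂ} (hF : Measurable F)
    {CF : ℝ} (hFb : ∀ U, ‖F U‖ ≤ CF) (hFH : IsDiagonalHalfObservable i j F) (hFg : IsGaugeInvariant F) :
    ∫ U, rpPhi ρ i j β F U ∂(linkMeasure L G) =
      ∫ U, gg ρ i j β F U * ((mirK ρ i j β U * backW ρ i j β 0 U : ℝ) : ℂ) ∂(linkMeasure L G) := by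
  rw [integral_rpPhi_eq_mirW ρ hL h4 hij hρ β hF hFb hFH hFg (s := L - 1) (by omega)]
  refine (integral_gg_mul_eq_avg ρ hL h4 hij hρ β hF hFb hFH hFg
    (R := fun U => mirW ρ i j β (L - 1) U * backW ρ i j β 0 U)
    ((continuous_mirW hρ _).mul (continuous_backW hρ 0)) (dg 0)).trans ?_
  refine integral_congr_ae (ae_of_all _ fun U => ?_)
  dsimp only
  congr 2
  have hpt : ∀ x : G, mirW ρ i j β (L - 1) (halfGauge i j (dg 0) x U) *
      backW ρ i j β 0 (halfGauge i j (dg 0) x U) =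
      mirW ρ i j β (L - 1) (halfGauge i j (dg 0) x U) * backW ρ i j β 0 U := fun x => by
    rw [backW_halfGauge_dg hL h4 hij]
  simp_rw [hpt]
  rw [integral_mul_const, integral_mirW_halfGauge_zero h4 hij]

/-- The back-layer induction: after `s` steps (`s ≤ L - 1`). -/
theorem integral_rpPhi_eq_backW (hL : Even L) (h4 : 4 ≤ L) {i j : Fin 2} (hij : i ≠ j)
    (hρ : Continuous ρ) (β : ℝ) {F : GaugeConfig 2 L G → ℂ} (hF : Measurable F)
    {CF : ℝ} (hFb : ∀ U, ‖F U‖ ≤ CF) (hFH : IsDiagonalHalfObservable i j F) (hFg : IsGaugeInvariant F)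
    {s : ℕ} (hs : s + 1 ≤ L) :
    ∫ U, rpPhi ρ i j β F U ∂(linkMeasure L G) =
      ∫ U, gg ρ i j β F U * ((mirK ρ i j β U * backW ρ i j β s U : ℝ) : ℂ) ∂(linkMeasure L G) := by
  induction s with
  | zero => exact integral_rpPhi_eq_mirK ρ hL h4 hij hρ β hF hFb hFH hFg
  | succ s ih =>
    rw [ih (by omega)]
    refine (integral_gg_mul_eq_avg ρ hL h4 hij hρ β hF hFb hFH hFg
      (R := fun U => mirK ρ i j β U * backW ρ i j β s U)
      ((continuous_mirK hρ).mul (continuous_backW hρ s)) (dgc i (s + 1))).trans ?_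
    refine integral_congr_ae (ae_of_all _ fun U => ?_)
    dsimp only
    congr 2
    have hpt : ∀ x : G, mirK ρ i j β (halfGauge i j (dgc i (s + 1)) x U) *
        backW ρ i j β s (halfGauge i j (dgc i (s + 1)) x U) =
        mirK ρ i j β U * backW ρ i j β s (halfGauge i j (dgc i (s + 1)) x U) := fun x => by
      rw [mirK_halfGauge_dgc h4 hij]
    simp_rw [hpt]
    rw [integral_const_mul, integral_backW_halfGauge h4 hij hL (by omega)]

/-- ★★ **The cut weight averages to the product of the two convolution kernels**:
`∫ g conj(g∘Θ) E dU = ∫ g conj(g∘Θ) A_{w^{⋆L}}(stairC L, stairD L) A_{w^{⋆L}}(stairDc L, stairCc L) dU`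
for every gauge-invariant closed-half observable (`(ℤ/L)²`, `L ≥ 4` even, every real `β`). -/
theorem integral_rpPhi_eq_kernels (hL : Even L) (h4 : 4 ≤ L) {i j : Fin 2} (hij : i ≠ j)
    (hρ : Continuous ρ) (β : ℝ) {F : GaugeConfig 2 L G → ℂ} (hF : Measurable F)
    {CF : ℝ} (hFb : ∀ U, ‖F U‖ ≤ CF) (hFH : IsDiagonalHalfObservable i j F) (hFg : IsGaugeInvariant F) :
    ∫ U, rpPhi ρ i j β F U ∂(linkMeasure L G) =
      ∫ U, gg ρ i j β F U * ((mirK ρ i j β U * backK ρ i j β U : ℝ) : ℂ) ∂(linkMeasure L G) := by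
  rw [integral_rpPhi_eq_backW ρ hL h4 hij hρ β hF hFb hFH hFg (s := L - 1) (by omega)]
  refine (integral_gg_mul_eq_avg ρ hL h4 hij hρ β hF hFb hFH hFg
    (R := fun U => mirK ρ i j β U * backW ρ i j β (L - 1) U)
    ((continuous_mirK hρ).mul (continuous_backW hρ _)) (dgc i 0)).trans ?_
  refine integral_congr_ae (ae_of_all _ fun U => ?_)
  dsimp only
  congr 2
  have hpt : ∀ x : G, mirK ρ i j β (halfGauge i j (dgc i 0) x U) *
      backW ρ i j β (L - 1) (halfGauge i j (dgc i 0) x U) =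
      mirK ρ i j β U * backW ρ i j β (L - 1) (halfGauge i j (dgc i 0) x U) := fun x => by
    rw [mirK_halfGauge_dgc h4 hij]
  simp_rw [hpt]
  rw [integral_const_mul, integral_backW_halfGauge_zero h4 hij hL]

end Assembly

end DiagRPTwo

end

end Summit.QuantumFields.GaugeBoot
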